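import Literature.IUT.HodgeArakelov.MonoThetaProjectiveNaturalTheta
import Literature.IUT.HodgeArakelov.MonoThetaProjectiveThetaEnv

/-!
# [IUTchII] Prop. 1.5 (ii)/(iii) at the genuine models — dictionary between the two in-tree `θ_env` constructions,
# and the lifting clause of (ii) at printed strength (proof-only companion; abc-iut cell, layer L6, node IUTchII:Prop1.5)

PROOF-ONLY companion (theorems only; no `def`, no new named fact) of abc-iut-w5-d233's
`MonoThetaProjectiveNaturalSystem.lean` / `MonoThetaProjectiveNaturalTheta.lean` (bridge B8 parts 7/8, p414240 /
p415559: `EtaleLevels.naturalSystem`, `MuLim`, `toMuLim`, `muLimEquivExtCycLim`, `thetaEnvDataNatural`) and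
abc-iut-w4-d030's `MonoThetaProjectiveModelSystem.lean` / `MonoThetaProjectiveThetaEnv.lean` (parts 5c/5d, p414139 /
p415224: `EtaleLevels.modelSystem`, `rigidLimHom`, `thetaEnvData`), written independently in the same hour and proved
equal as systems by abc-iut-w4-d038 (`naturalSystem_eq_modelSystem`, `MonoThetaProjectiveNaturalSystemProofs.lean`,
p415622). S. Mochizuki, *Inter-universal Teichmüller theory II*, kurims manuscript (Dec. 2020), §1, Prop. 1.5 (ii),
(iii), pp. 29–30 [claim: Mochizuki2012, status: disputed] (IUTchII §1 Prop 1.5 (ii)(iii), kurims pp.29-30): "(ii) …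
any isomorphism of topological groups `Π_X(M^Θ_{M'}) ⥲ Π_X(M^Θ_M)`, where `M` divides `M'`, lifts to a morphism of
mono-theta environments `M^Θ_{M'} → M^Θ_M` [cf. [EtTh], Corollary 2.18, (iv)]. (iii) … a uniquely determined
cyclotomic rigidity isomorphism `(l·Δ_Θ)(M^Θ_*) ⥲ Π_μ(M^Θ_*)` [i.e., obtained by applying the cyclotomic rigidity
isomorphisms of Definition 1.1, (ii), to the various members of the projective system `M^Θ_*`]"; [EtTh] Cor. 2.18
(iv) p. 287 (PRIMS PDF p. 61) [cite: MochizukiEtTh2009, Cor 2.18(iv) p.61], §1 p. 238 (PDF p. 12) "`Δ_Θ (≅ Ẑ(1))`"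
[cite: MochizukiEtTh2009, §1 p.12].

* `EtaleLevels.rigidLimHom_apply_eq` / `coe_rigidLimHom_eq_comp` — abc-iut-w4-d030's limit rigidity map
  `rigidLimHom : (l·Δ_Θ)(Π^tp_{X̲̲}) → Π_μ(𝕄_*)` IS abc-iut-w5-d233's `toMuLim : (l·Δ_Θ)(Π^tp_{X̲̲}) → lim_M μ_M` followed
  by the identification `muLimEquivExtCycLim : lim_M μ_M ⥲ Π_μ(𝕄_*)` (componentwise `(red_M a, 1)`), PROVED;
* **`EtaleLevels.bijective_rigidLimHom_iff_bijective_toMuLim`** — hence the two files' single non-[EtTh] hypothesis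
  is ONE statement: d030's `Function.Bijective rigidLimHom` ⟺ d233's `Function.Bijective toMuLim`, i.e.
  "`(l·Δ_Θ) ⥲ lim_M μ_M`" = the `M`-adic form of [EtTh] §1 "`Δ_Θ (≅ Ẑ(1))`" (separatedness + completeness of `l·Δ_Θ`),
  which the [EtTh] interface (abstract `Δ_Θ`) does not record; `prop15_ii_iii_modelSystem_of_bijective_toMuLim` reads
  d030's conclusion from d233's hypothesis;
* `EtaleLevels.exists_iso_comp_red_of_continuousMulEquiv` — Prop. 1.5 (ii), second sentence, AT THE PRINTED
  STRENGTH for the natural system: the lift of a topological isomorphism `γ : Π_X(𝕄_{M'}) ⥲ Π_X(𝕄_M)` is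
  `α ∘ red_{M',M}` with `α` an automorphism of the mod-`M` model AS A MONO-THETA ENVIRONMENT (abc-iut-L6-t1's
  `MonoThetaEnv.Iso`: carries `D` and `s^Θ`) — a morphism of mono-theta environments in the sense of [EtTh] Def.
  2.13 (ii), not merely the continuous surjection of underlying groups frozen in `transitionsAreIsos` (audit INFO of
  abc-iut-w5-d089 on p414240); CONDITIONAL on the level-`M` named fact `ThetaEnvData.Cor218_iv_surjective` and the
  `Π^tp_{Y̲̲}`-stability clause of [EtTh] Cor. 2.18 (i), exactly as parts 5c/7.

HONEST FRAMING: bookkeeping over landed files; the [IUTchII] claim key `Mochizuki2012` is DISPUTED (D-0012); the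
[EtTh] inputs are named hypotheses (FACT-policy); no side is taken on [IUTchIII] Cor. 3.12; typed ≠ discharged
elsewhere.
-/

noncomputable section

namespace Literature.IUT.HodgeArakelov

open Literature.AnabelianGeometry.EtaleTheta Literature.AnabelianGeometry.SemiGraphs
open scoped Literature.AnabelianGeometry.EtaleTheta

namespace EtaleLevels

variable {p : ℕ} [Fact p.Prime] {D : Literature.AnabelianGeometry.EtaleTheta.ThetaSetting p}
  {E : D.EtaleThetaData} {l : ℕ} (C : E.DoubleUnderline l) (hC : D.Compat) (hS : D.Sec2Hyps)
  (hl : l.Prime) (hp2 : p ≠ 2) (hpl : p ≠ l) (hζ : ∃ ζ : D.K, IsPrimitiveRoot ζ (4 * l))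
  (mods : ∀ M : ℕ+, D.CyclotomeMod l M)
  (f : contCocycles D.toTheta D.DeltaTheta C.GtpYdduu) (hf : f ∈ C.rootCocycles hC)
  (hmods : ∀ (M M' : ℕ+) (h : (M : ℕ) ∣ (M' : ℕ)) (x : D.lDeltaTheta l),
    MuN.red p M M' h ((mods M').red x) = (mods M).red x)
  (h15 : Literature.AnabelianGeometry.EtaleTheta.ThetaSetting.Prop15iii E hC) (L : C.CuspLabels)
  (hZ : ∀ M : ℕ+, Nonempty (ModelCyclotomes.lDeltaQuot (C.rigidData (mods M) hC hS h15 L) ≃*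
    Literature.IUT.HodgeTheaters.ZHat))

/-! ## d030's `rigidLimHom` = d233's `toMuLim` followed by `lim_M μ_M ⥲ Π_μ(𝕄_*)` -/

/-- **The two limit rigidity maps agree componentwise**: for every `a ∈ (l·Δ_Θ)(Π^tp_{X̲̲})` and every level `M`, the
`M`-component of abc-iut-w4-d030's `rigidLimHom a` and of abc-iut-w5-d233's `muLimEquivExtCycLim (toMuLim a)` are the
same element `(red_M a, 1)` of `Π^tp_{Y̲̲}[μ_M]`. [claim: Mochizuki2012, status: disputed] (IUTchII §1 Prop 1.5 (iii), kurims p.29) -/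
theorem rigidLimHom_apply_eq (a : (EtaleThetaDataOfSetting.lDeltaSubquotient C).carrier) (M : ℕ+) :
    ((rigidLimHom C hC hS hl hp2 hpl hζ mods f hf hmods h15 L hZ a :
        ∀ M', ((modelSystem C hC hS hl hp2 hpl hζ mods f hf hmods h15 L hZ).env M').Pi) M) =
      ((muLimEquivExtCycLim C hC hS hl hp2 hpl hζ mods f hf hmods h15 L hZ
          (toMuLim C hC hS mods hmods h15 L a) :
        (naturalSystem C hC hS hl hp2 hpl hζ mods f hf hmods h15 L hZ).extCycLim) :
        ∀ M', ((naturalSystem C hC hS hl hp2 hpl hζ mods f hf hmods h15 L hZ).env M').Pi) M := by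
  induction a using QuotientGroup.induction_on with
  | H g =>
    rw [rigidLimHom_apply_coe, coe_rigid_iso_intCompat_mk]
    rfl

/-- **d030's `rigidLimHom` IS d233's `muLimEquivExtCycLim ∘ toMuLim`** (as functions).
[claim: Mochizuki2012, status: disputed] (IUTchII §1 Prop 1.5 (iii), kurims p.29) -/
theorem coe_rigidLimHom_eq_comp :
    (fun a => ((rigidLimHom C hC hS hl hp2 hpl hζ mods f hf hmods h15 L hZ a :
        (modelSystem C hC hS hl hp2 hpl hζ mods f hf hmods h15 L hZ).extCycLim) :
        ∀ M', ((modelSystem C hC hS hl hp2 hpl hζ mods f hf hmods h15 L hZ).env M').Pi)) =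
      fun a => ((muLimEquivExtCycLim C hC hS hl hp2 hpl hζ mods f hf hmods h15 L hZ
          (toMuLim C hC hS mods hmods h15 L a) :
        (naturalSystem C hC hS hl hp2 hpl hζ mods f hf hmods h15 L hZ).extCycLim) :
        ∀ M', ((naturalSystem C hC hS hl hp2 hpl hζ mods f hf hmods h15 L hZ).env M').Pi) :=
  funext fun a => funext fun M => rigidLimHom_apply_eq C hC hS hl hp2 hpl hζ mods f hf hmods h15 L hZ a M

/-- **ONE hypothesis**: abc-iut-w4-d030's `Function.Bijective rigidLimHom` (the limit rigidity map is onto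
`Π_μ(𝕄_*)` and injective) ⟺ abc-iut-w5-d233's `Function.Bijective toMuLim` ("`(l·Δ_Θ) ⥲ lim_M μ_M`", the `M`-adic
form of [EtTh] §1 "`Δ_Θ (≅ Ẑ(1))`") — since `lim_M μ_M ⥲ Π_μ(𝕄_*)` is a bijection.
[claim: Mochizuki2012, status: disputed] (IUTchII §1 Prop 1.5 (iii), kurims p.29) [cite: MochizukiEtTh2009, §1 p.12] -/
theorem bijective_rigidLimHom_iff_bijective_toMuLim :
    Function.Bijective (rigidLimHom C hC hS hl hp2 hpl hζ mods f hf hmods h15 L hZ) ↔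
      Function.Bijective (toMuLim C hC hS mods hmods h15 L) := by
  have key : (⇑(rigidLimHom C hC hS hl hp2 hpl hζ mods f hf hmods h15 L hZ) :
      (EtaleThetaDataOfSetting.lDeltaSubquotient C).carrier →
        (naturalSystem C hC hS hl hp2 hpl hζ mods f hf hmods h15 L hZ).extCycLim) =
      ⇑(muLimEquivExtCycLim C hC hS hl hp2 hpl hζ mods f hf hmods h15 L hZ) ∘
        ⇑(toMuLim C hC hS mods hmods h15 L) := by
    funext a
    exact Subtype.ext (funext fun M => rigidLimHom_apply_eq C hC hS hl hp2 hpl hζ mods f hf hmods h15 L hZ a M)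
  change Function.Bijective (⇑(rigidLimHom C hC hS hl hp2 hpl hζ mods f hf hmods h15 L hZ) :
      (EtaleThetaDataOfSetting.lDeltaSubquotient C).carrier →
        (naturalSystem C hC hS hl hp2 hpl hζ mods f hf hmods h15 L hZ).extCycLim) ↔ _
  rw [key]
  exact (MulEquiv.bijective _).of_comp_iff' _

/-- abc-iut-w4-d030's `Prop15_ii_iii (modelSystem …)` (part 5d) read from abc-iut-w5-d233's hypothesis
`Function.Bijective toMuLim`. [claim: Mochizuki2012, status: disputed] (IUTchII §1 Prop 1.5 (ii)(iii), kurims pp.29-30) -/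
theorem prop15_ii_iii_modelSystem_of_bijective_toMuLim
    (hcharY : EtaleThetaDataOfSetting.PiYddCharacteristic C)
    (hchar : Literature.AnabelianGeometry.EtaleTheta.IsTopCharacteristic ↥C.Huu (D.GtpY.subgroupOf C.Huu))
    (hsurj : ∀ M : ℕ+, (levelData C hC hS mods M).Cor218_iv_surjective)
    (hlim : Function.Bijective (toMuLim C hC hS mods hmods h15 L)) :
    Prop15_ii_iii (modelSystem C hC hS hl hp2 hpl hζ mods f hf hmods h15 L hZ) :=
  prop15_ii_iii_modelSystem C hC hS hl hp2 hpl hζ mods f hf hmods h15 L hZ hcharY hchar hsurj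
    ((bijective_rigidLimHom_iff_bijective_toMuLim C hC hS hl hp2 hpl hζ mods f hf hmods h15 L hZ).2 hlim)

/-! ## The lifting clause of Prop. 1.5 (ii) at printed strength: the lift is a MORPHISM of mono-theta environments -/

include hmods in
/-- **Prop. 1.5 (ii), second sentence, at the printed strength** ("any isomorphism of topological groups
`Π_X(M^Θ_{M'}) ⥲ Π_X(M^Θ_M)`, where `M` divides `M'`, lifts to a MORPHISM OF MONO-THETA ENVIRONMENTS
`M^Θ_{M'} → M^Θ_M`") for the natural system of `X̲̲_K`: the lift constructed in parts 5c/7 is `α ∘ red_{M',M}` with `α`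
an automorphism of the mod-`M` model AS A MONO-THETA ENVIRONMENT (abc-iut-L6-t1's `MonoThetaEnv.Iso`, carrying `D` and
`s^Θ`) — i.e. a morphism of mono-theta environments in the sense of [EtTh] Def. 2.13 (ii) (structure isomorphism ∘
reduction), not merely a continuous surjection of underlying groups (the weaker form frozen in
`transitionsAreIsos`; audit INFO of abc-iut-w5-d089 on p414240). CONDITIONAL on the same named [EtTh] inputs.
[claim: Mochizuki2012, status: disputed] (IUTchII §1 Prop 1.5 (ii), kurims p.29) [cite: MochizukiEtTh2009, Cor 2.18(iv) p.61] -/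
theorem exists_iso_comp_red_of_continuousMulEquiv
    (hsurj : ∀ M : ℕ+, (levelData C hC hS mods M).Cor218_iv_surjective)
    (hY : ∀ (M : ℕ+) (γ : (levelData C hC hS mods M).PiX ≃ₜ* (levelData C hC hS mods M).PiX),
      (levelData C hC hS mods M).PiY.map γ.toMulEquiv.toMonoidHom = (levelData C hC hS mods M).PiY)
    {M M' : ℕ+} (h : (M : ℕ) ∣ (M' : ℕ))
    (γ : ((naturalSystem C hC hS hl hp2 hpl hζ mods f hf hmods h15 L hZ).recon M').PiX ≃ₜ*
      ((naturalSystem C hC hS hl hp2 hpl hζ mods f hf hmods h15 L hZ).recon M).PiX) :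
    ∃ α : MonoThetaEnv.Iso ((modelFamily C hC hS hl hp2 hpl hζ mods f hf).modelEnv M)
        ((modelFamily C hC hS hl hp2 hpl hζ mods f hf).modelEnv M),
      ∀ x, γ (((naturalSystem C hC hS hl hp2 hpl hζ mods f hf hmods h15 L hZ).recon M').inclY
          (((naturalSystem C hC hS hl hp2 hpl hζ mods f hf hmods h15 L hZ).recon M').projY x)) =
        ((naturalSystem C hC hS hl hp2 hpl hζ mods f hf hmods h15 L hZ).recon M).inclY
          (((naturalSystem C hC hS hl hp2 hpl hζ mods f hf hmods h15 L hZ).recon M).projY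
            (α.iso (red C hC hS mods h x))) := by
  obtain ⟨αM, hα⟩ := hsurj M (eta0 C hC mods f hf M) (eta0_mem C hC hS mods f hf M) γ (hY M γ)
  refine ⟨{ iso := αM.e
            map_D := map_congr_modelD_of_etaleIso C hC hS hl hp2 hpl hζ mods f hf M αM
            map_theta := αM.map_sTheta }, fun x => ?_⟩
  change γ ((CycEnvelope.proj (levelData C hC hS mods M').augY (levelData C hC hS mods M').chi x :
      (levelData C hC hS mods M').PiY) : C.Huu) =
    ((CycEnvelope.proj (levelData C hC hS mods M).augY (levelData C hC hS mods M).chi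
      (αM.e (red C hC hS mods h x)) : (levelData C hC hS mods M).PiY) : C.Huu)
  rw [hα (red C hC hS mods h x)]
  rfl

include hmods in
/-- The same for abc-iut-w4-d030's `modelSystem` (equal to `naturalSystem` by `rfl`, abc-iut-w4-d038's
`naturalSystem_eq_modelSystem`), with the `Π^tp_{Y̲̲}`-stability in d030's `IsTopCharacteristic` currency.
[claim: Mochizuki2012, status: disputed] (IUTchII §1 Prop 1.5 (ii), kurims p.29) [cite: MochizukiEtTh2009, Cor 2.18(iv) p.61] -/
theorem exists_iso_comp_red_of_continuousMulEquiv_modelSystem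
    (hchar : Literature.AnabelianGeometry.EtaleTheta.IsTopCharacteristic ↥C.Huu (D.GtpY.subgroupOf C.Huu))
    (hsurj : ∀ M : ℕ+, (levelData C hC hS mods M).Cor218_iv_surjective)
    {M M' : ℕ+} (h : (M : ℕ) ∣ (M' : ℕ))
    (γ : ((modelSystem C hC hS hl hp2 hpl hζ mods f hf hmods h15 L hZ).recon M').PiX ≃ₜ*
      ((modelSystem C hC hS hl hp2 hpl hζ mods f hf hmods h15 L hZ).recon M).PiX) :
    ∃ α : MonoThetaEnv.Iso ((modelFamily C hC hS hl hp2 hpl hζ mods f hf).modelEnv M)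
        ((modelFamily C hC hS hl hp2 hpl hζ mods f hf).modelEnv M),
      ∀ x, γ (((modelSystem C hC hS hl hp2 hpl hζ mods f hf hmods h15 L hZ).recon M').inclY
          (((modelSystem C hC hS hl hp2 hpl hζ mods f hf hmods h15 L hZ).recon M').projY x)) =
        ((modelSystem C hC hS hl hp2 hpl hζ mods f hf hmods h15 L hZ).recon M).inclY
          (((modelSystem C hC hS hl hp2 hpl hζ mods f hf hmods h15 L hZ).recon M).projY
            (α.iso (red C hC hS mods h x))) :=
  exists_iso_comp_red_of_continuousMulEquiv C hC hS hl hp2 hpl hζ mods f hf hmods h15 L hZ hsurj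
    (fun _ γ' => hchar γ') h γ

end EtaleLevels

end Literature.IUT.HodgeArakelov
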